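import Literature.Analysis.FluidPDE.CheskidovScalarEstimates
import Literature.Analysis.FluidPDE.PassiveScalarMaximumPrinciple
import HarnessLib

/-!
# Stability of passive scalars in the drift (Johansson–Sorella 2024, Lemma 2.2)

Topic `Literature/Analysis/FluidPDE` (passive scalar cluster; support lemma of the printed proof of
`Literature.Analysis.FluidPDE.johanssonSorella_autonomousForce_anomalousDissipation`, used in the
proofs of Prop. 4.2 and of Thm. 1.5 of the source). C. J. P. Johansson, M. Sorella, *Anomalous
dissipation via spontaneous stochasticity with a two-dimensional autonomous velocity field*,
arXiv:2409.03599 (Duke Math. J. 2025), Lemma 2.2 (p. 8):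

"Let `u₁, u₂ ∈ L^∞((0,1) × T²)` be two divergence-free velocity fields and `θ_in ∈ L^∞(T²)`. Let
`θ_{κ,1}` be the unique solution of (ADV-DIFF) with `u₁` and `θ_{κ,2}` be the unique solution of
(ADV-DIFF) with `u₂`, then
`∫ |θ_{κ,1}(t) - θ_{κ,2}(t)|² + κ ∫₀ᵗ ∫ |∇(θ_{κ,1} - θ_{κ,2})|² ≤ (‖θ_in‖²_{L^∞} / κ) ∫₀ᵗ ∫ |u₁ - u₂|²`
for any `t ∈ (0,1)`."

The printed proof is the energy method for `w = θ_{κ,1} - θ_{κ,2}`: the identity (2.1),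
`∂ₜ(w²/2) + u₁·∇w w + (u₁ - u₂)·∇θ_{κ,2} w = κΔw w`, integration over `T^d`, integration by
parts in the cross term ("using the divergence-free condition … and integration by parts"),
Young's inequality `2|u₁-u₂||∇w||θ₂| ≤ κ|∇w|² + κ⁻¹|u₁-u₂|²|θ₂|²`, and the maximum principle for
`θ_{κ,2}`. We formalize exactly this for CLASSICAL solutions on `T^d` (any dimension), in two steps
mirroring the print:

* `Torus.IsClassicalScalarTransportOn.integral_timeDerivWithin_sub_sq_le_of_drifts` — the
  differential inequality `d/dt ‖w(t)‖² ≤ -κ‖∇w(t)‖² + (M²/κ) ‖u₁(t) - u₂(t)‖²_{L²}` at every `t` of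
  the time set, given the pointwise bound `|θ₂(t, ·)| ≤ M`;
* `Torus.IsClassicalScalarTransportOn.integral_sub_sq_add_dissipation_le_of_drifts` — the
  integrated form on `[a, t] ⊆ [a, b] ⊆ S` from a common datum `θ₁(a) = θ₂(a)`:
  `‖w(t)‖²_{L²} + κ ∫ₐᵗ ‖∇w‖² ≤ (M²/κ) ∫ₐᵗ ‖u₁ - u₂‖²_{L²}`, with the sup bound `M` on `θ₂` over
  `[a, b] × T^d` as an explicit hypothesis (the energy argument proper);
* `Torus.IsClassicalScalarTransportOn.integral_sub_sq_add_dissipation_le_of_drifts_init` — the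
  lemma AS PRINTED, with `M` a bound on the common datum only, `|θ_in| ≤ M` ("using the maximum
  principle on `θ_{κ,2}`": `Torus.IsClassicalScalarTransportOn.abs_le_of_forall_abs_init_le`,
  `PassiveScalarMaximumPrinciple`). The
calculus is the tree's torus toolkit already used for Cheskidov's closeness estimate (4.3)
(`CheskidovScalarEstimates`): `IsSmoothSpaceTimeOn.hasDerivWithinAt_slice/_integral`, Green's
identity `Torus.integral_mul_laplacian_eq_neg_integral_inner_gradient`, the transport identities
`Torus.integral_mul_inner_gradient_self_eq_zero`, `Torus.integral_mul_inner_gradient_add_eq_zero`.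
Theorems only; no definition and no named fact (D-0026).

## References

* C. J. P. Johansson, M. Sorella, arXiv:2409.03599v2 (2024), Lemma 2.2 and identity (2.1), p. 8.
  [`JohanssonSorella2024`]
-/

open MeasureTheory Set Filter
open _root_.Topology
open scoped InnerProductSpace ContDiff ENNReal NNReal

noncomputable section

namespace Literature.Analysis.FluidPDE

namespace Torus

variable {d : Type*} [Fintype d] [DecidableEq d]

omit [Fintype d] [DecidableEq d] in
/-- Young's inequality in the form used for (2.1): `2 M a b ≤ κ b² + (M²/κ) a²` for `κ > 0`
(`(κ b - M a)² ≥ 0`). [cite: JohanssonSorella2024, Lemma 2.2 (proof)] -/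
theorem two_mul_mul_mul_le_of_pos {κ : ℝ} (hκ : 0 < κ) (M a b : ℝ) :
    2 * M * a * b ≤ κ * b ^ 2 + M ^ 2 / κ * a ^ 2 := by
  rw [← sub_nonneg]
  have hκ' : κ ≠ 0 := hκ.ne'
  have h : κ * b ^ 2 + M ^ 2 / κ * a ^ 2 - 2 * M * a * b = (κ * b - M * a) ^ 2 / κ := by
    field_simp
    ring
  rw [h]
  exact div_nonneg (sq_nonneg _) hκ.le

namespace IsClassicalScalarTransportOn

variable {S : Set ℝ} {κ : ℝ} {u₁ u₂ : ℝ → UnitAddTorus d → EuclideanSpace ℝ d}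
  {θ₁ θ₂ : ℝ → UnitAddTorus d → ℝ}

/-- **The differential inequality of Lemma 2.2** (source, identity (2.1) integrated over `T^d`).
For two classical solutions `θ₁`, `θ₂` of the advection–diffusion equation with the same
diffusivity `κ > 0` and (smooth, divergence-free) drifts `u₁`, `u₂` on a time set `S` of unique
differentiability, and a pointwise bound `|θ₂(t, ·)| ≤ M`, the difference `w = θ₁ - θ₂` satisfies
`∫ ∂ₜ(w²)(t) ≤ -κ ‖∇w(t)‖²_{L²} + (M²/κ) ∫ ‖u₁(t) - u₂(t)‖²`.
Proof as printed: `∂ₜw = κΔw - u₁·∇w - (u₁-u₂)·∇θ₂`; `∫ wΔw = -‖∇w‖²`, `∫ w u₁·∇w = 0`,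
`-∫ w (u₁-u₂)·∇θ₂ = ∫ θ₂ (u₁-u₂)·∇w ≤ ½κ‖∇w‖² + ½κ⁻¹M²‖u₁-u₂‖²`. [cite: JohanssonSorella2024, Lemma 2.2 and (2.1), p. 8] -/
theorem integral_timeDerivWithin_sub_sq_le_of_drifts (h₁ : IsClassicalScalarTransportOn S κ u₁ θ₁)
    (h₂ : IsClassicalScalarTransportOn S κ u₂ θ₂) (hκ : 0 < κ) (hU : UniqueDiffOn ℝ S) {t : ℝ}
    (ht : t ∈ S) {M : ℝ} (hM : ∀ x, |θ₂ t x| ≤ M) :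
    ∫ x, FunctionSpaces.Torus.timeDerivWithin S
        (fun s x => (θ₁ s x - θ₂ s x) * (θ₁ s x - θ₂ s x)) t x ≤
      -κ * scalarGradNormSq (θ₁ t - θ₂ t) + M ^ 2 / κ * ∫ x, ‖u₁ t x - u₂ t x‖ ^ 2 := by
  have hθ₁s := h₁.smooth_scalar
  have hθ₂s := h₂.smooth_scalar
  have hws : FunctionSpaces.Torus.IsSmoothSpaceTimeOn S (fun s x => θ₁ s x - θ₂ s x) := hθ₁s.sub hθ₂s
  have hθ₁t : FunctionSpaces.Torus.IsSmooth (θ₁ t) := hθ₁s.isSmooth_slice ht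
  have hθ₂t : FunctionSpaces.Torus.IsSmooth (θ₂ t) := hθ₂s.isSmooth_slice ht
  have hu₁t : FunctionSpaces.Torus.IsSmooth (u₁ t) := h₁.smooth_velocity.isSmooth_slice ht
  have hu₂t : FunctionSpaces.Torus.IsSmooth (u₂ t) := h₂.smooth_velocity.isSmooth_slice ht
  have hwt : FunctionSpaces.Torus.IsSmooth (θ₁ t - θ₂ t) := hθ₁t.sub hθ₂t
  have hδu : FunctionSpaces.Torus.IsSmooth (u₁ t - u₂ t) := hu₁t.sub hu₂t
  have hdiv₁ : FunctionSpaces.Torus.IsDivFree (u₁ t) := h₁.divFree t ht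
  have hdivδ : FunctionSpaces.Torus.IsDivFree (u₁ t - u₂ t) := fun x => by
    rw [FunctionSpaces.Torus.divergence_sub (hu₁t.isContDiff (by simp)) (hu₂t.isContDiff (by simp)),
      hdiv₁ x, h₂.divFree t ht x, sub_zero]
  have hgw : ∀ x, FunctionSpaces.Torus.gradient (θ₁ t - θ₂ t) x =
      FunctionSpaces.Torus.gradient (θ₁ t) x - FunctionSpaces.Torus.gradient (θ₂ t) x := fun x =>
    FunctionSpaces.Torus.gradient_sub (hθ₁t.isContDiff (by simp)) (hθ₂t.isContDiff (by simp)) x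
  -- the equation for `w = θ₁ - θ₂` (source, (2.1))
  have hdw : ∀ x, FunctionSpaces.Torus.timeDerivWithin S (fun s x => θ₁ s x - θ₂ s x) t x =
      κ * (FunctionSpaces.Torus.laplacian (θ₁ t) x - FunctionSpaces.Torus.laplacian (θ₂ t) x) -
        ⟪u₁ t x, FunctionSpaces.Torus.gradient (θ₁ t - θ₂ t) x⟫_ℝ -
        ⟪u₁ t x - u₂ t x, FunctionSpaces.Torus.gradient (θ₂ t) x⟫_ℝ := by
    intro x
    have hd : HasDerivWithinAt (fun s => θ₁ s x - θ₂ s x)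
        (FunctionSpaces.Torus.timeDerivWithin S θ₁ t x - FunctionSpaces.Torus.timeDerivWithin S θ₂ t x) S t :=
      (hθ₁s.hasDerivWithinAt_slice ht x).sub (hθ₂s.hasDerivWithinAt_slice ht x)
    rw [FunctionSpaces.Torus.timeDerivWithin, hd.derivWithin (hU t ht)]
    have e₁ := h₁.transport t ht x
    have e₂ := h₂.transport t ht x
    rw [hgw x, inner_sub_right, inner_sub_left]
    linarith
  have hdw2 : ∀ x, FunctionSpaces.Torus.timeDerivWithin S
      (fun s x => (θ₁ s x - θ₂ s x) * (θ₁ s x - θ₂ s x)) t x =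
      2 * κ * ((θ₁ t - θ₂ t) x * FunctionSpaces.Torus.laplacian (θ₁ t) x) -
        2 * κ * ((θ₁ t - θ₂ t) x * FunctionSpaces.Torus.laplacian (θ₂ t) x) -
        2 * ((θ₁ t - θ₂ t) x * ⟪u₁ t x, FunctionSpaces.Torus.gradient (θ₁ t - θ₂ t) x⟫_ℝ) -
        2 * ((θ₁ t - θ₂ t) x * ⟪(u₁ t - u₂ t) x, FunctionSpaces.Torus.gradient (θ₂ t) x⟫_ℝ) := by
    intro x
    have hd : HasDerivWithinAt (fun s => (θ₁ s x - θ₂ s x) * (θ₁ s x - θ₂ s x))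
        (FunctionSpaces.Torus.timeDerivWithin S (fun s x => θ₁ s x - θ₂ s x) t x * (θ₁ t x - θ₂ t x) +
          (θ₁ t x - θ₂ t x) *
            FunctionSpaces.Torus.timeDerivWithin S (fun s x => θ₁ s x - θ₂ s x) t x) S t :=
      (hws.hasDerivWithinAt_slice ht x).mul (hws.hasDerivWithinAt_slice ht x)
    rw [FunctionSpaces.Torus.timeDerivWithin, hd.derivWithin (hU t ht), hdw x, Pi.sub_apply,
      Pi.sub_apply]
    ring
  -- integrability of the four terms
  have i1 : Integrable (fun x => (θ₁ t - θ₂ t) x * FunctionSpaces.Torus.laplacian (θ₁ t) x) volume :=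
    (hwt.smul' hθ₁t.laplacian).integrable
  have i2 : Integrable (fun x => (θ₁ t - θ₂ t) x * FunctionSpaces.Torus.laplacian (θ₂ t) x) volume :=
    (hwt.smul' hθ₂t.laplacian).integrable
  have i3 : Integrable (fun x => (θ₁ t - θ₂ t) x *
      ⟪u₁ t x, FunctionSpaces.Torus.gradient (θ₁ t - θ₂ t) x⟫_ℝ) volume :=
    (hwt.smul' (hu₁t.inner hwt.gradient)).integrable
  have i4 : Integrable (fun x => (θ₁ t - θ₂ t) x *
      ⟪(u₁ t - u₂ t) x, FunctionSpaces.Torus.gradient (θ₂ t) x⟫_ℝ) volume :=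
    (hwt.smul' (hδu.inner hθ₂t.gradient)).integrable
  have j1 : Integrable (fun x => 2 * κ * ((θ₁ t - θ₂ t) x * FunctionSpaces.Torus.laplacian (θ₁ t) x))
      volume := i1.const_mul _
  have j2 : Integrable (fun x => 2 * κ * ((θ₁ t - θ₂ t) x * FunctionSpaces.Torus.laplacian (θ₂ t) x))
      volume := i2.const_mul _
  have j3 : Integrable (fun x => 2 * ((θ₁ t - θ₂ t) x *
      ⟪u₁ t x, FunctionSpaces.Torus.gradient (θ₁ t - θ₂ t) x⟫_ℝ)) volume := i3.const_mul _
  have j4 : Integrable (fun x => 2 * ((θ₁ t - θ₂ t) x *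
      ⟪(u₁ t - u₂ t) x, FunctionSpaces.Torus.gradient (θ₂ t) x⟫_ℝ)) volume := i4.const_mul _
  have j12 : Integrable (fun x => 2 * κ * ((θ₁ t - θ₂ t) x * FunctionSpaces.Torus.laplacian (θ₁ t) x) -
      2 * κ * ((θ₁ t - θ₂ t) x * FunctionSpaces.Torus.laplacian (θ₂ t) x)) volume := j1.sub j2
  have j123 : Integrable (fun x => 2 * κ * ((θ₁ t - θ₂ t) x * FunctionSpaces.Torus.laplacian (θ₁ t) x) -
      2 * κ * ((θ₁ t - θ₂ t) x * FunctionSpaces.Torus.laplacian (θ₂ t) x) -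
      2 * ((θ₁ t - θ₂ t) x * ⟪u₁ t x, FunctionSpaces.Torus.gradient (θ₁ t - θ₂ t) x⟫_ℝ)) volume :=
    j12.sub j3
  simp_rw [hdw2]
  rw [integral_sub j123 j4, integral_sub j12 j3, integral_sub j1 j2, integral_const_mul,
    integral_const_mul, integral_const_mul, integral_const_mul]
  -- `∫ w Δθᵢ = -∫ ⟪∇w, ∇θᵢ⟫`, hence `∫ w (Δθ₁ - Δθ₂) = -‖∇w‖²`
  have hG : (∫ x, (θ₁ t - θ₂ t) x * FunctionSpaces.Torus.laplacian (θ₁ t) x) -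
      ∫ x, (θ₁ t - θ₂ t) x * FunctionSpaces.Torus.laplacian (θ₂ t) x =
        -scalarGradNormSq (θ₁ t - θ₂ t) := by
    rw [integral_mul_laplacian_eq_neg_integral_inner_gradient hwt hθ₁t,
      integral_mul_laplacian_eq_neg_integral_inner_gradient hwt hθ₂t, neg_sub_neg,
      ← integral_sub (hwt.gradient.inner hθ₂t.gradient).integrable
        (hwt.gradient.inner hθ₁t.gradient).integrable]
    rw [scalarGradNormSq, ← integral_neg]
    refine integral_congr_ae (Eventually.of_forall fun x => ?_)
    show ⟪FunctionSpaces.Torus.gradient (θ₁ t - θ₂ t) x, FunctionSpaces.Torus.gradient (θ₂ t) x⟫_ℝ -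
        ⟪FunctionSpaces.Torus.gradient (θ₁ t - θ₂ t) x, FunctionSpaces.Torus.gradient (θ₁ t) x⟫_ℝ =
      -(‖FunctionSpaces.Torus.gradient (θ₁ t - θ₂ t) x‖ ^ 2)
    rw [← inner_sub_right, ← neg_sub (FunctionSpaces.Torus.gradient (θ₁ t) x)
      (FunctionSpaces.Torus.gradient (θ₂ t) x), inner_neg_right, ← hgw x, real_inner_self_eq_norm_sq]
  -- the transport term vanishes
  have hT : ∫ x, (θ₁ t - θ₂ t) x * ⟪u₁ t x, FunctionSpaces.Torus.gradient (θ₁ t - θ₂ t) x⟫_ℝ = 0 :=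
    integral_mul_inner_gradient_self_eq_zero hu₁t hdiv₁ hwt
  -- the cross term: integrate by parts and use Young's inequality
  have hX : -(2 * ∫ x, (θ₁ t - θ₂ t) x *
      ⟪(u₁ t - u₂ t) x, FunctionSpaces.Torus.gradient (θ₂ t) x⟫_ℝ) ≤
      κ * scalarGradNormSq (θ₁ t - θ₂ t) + M ^ 2 / κ * ∫ x, ‖u₁ t x - u₂ t x‖ ^ 2 := by
    have hibp := integral_mul_inner_gradient_add_eq_zero hδu hdivδ hwt hθ₂t
    have hflip : -(2 * ∫ x, (θ₁ t - θ₂ t) x *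
        ⟪(u₁ t - u₂ t) x, FunctionSpaces.Torus.gradient (θ₂ t) x⟫_ℝ) =
        2 * ∫ x, ⟪(u₁ t - u₂ t) x, FunctionSpaces.Torus.gradient (θ₁ t - θ₂ t) x⟫_ℝ * θ₂ t x := by
      linarith
    rw [hflip]
    have i5 : Integrable (fun x =>
        ⟪(u₁ t - u₂ t) x, FunctionSpaces.Torus.gradient (θ₁ t - θ₂ t) x⟫_ℝ * θ₂ t x) volume :=
      ((hδu.inner hwt.gradient).smul' hθ₂t).integrable
    have k1 : Integrable (fun x => κ * ‖FunctionSpaces.Torus.gradient (θ₁ t - θ₂ t) x‖ ^ 2) volume :=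
      (hwt.gradient.continuous.norm.pow 2).integrable_unitAddTorus.const_mul κ
    have k2 : Integrable (fun x => M ^ 2 / κ * ‖u₁ t x - u₂ t x‖ ^ 2) volume :=
      (hδu.continuous.norm.pow 2).integrable_unitAddTorus.const_mul _
    have i6 : Integrable (fun x => κ * ‖FunctionSpaces.Torus.gradient (θ₁ t - θ₂ t) x‖ ^ 2 +
        M ^ 2 / κ * ‖u₁ t x - u₂ t x‖ ^ 2) volume := k1.add k2
    have hpt : ∀ x, 2 * (⟪(u₁ t - u₂ t) x, FunctionSpaces.Torus.gradient (θ₁ t - θ₂ t) x⟫_ℝ * θ₂ t x) ≤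
        κ * ‖FunctionSpaces.Torus.gradient (θ₁ t - θ₂ t) x‖ ^ 2 + M ^ 2 / κ * ‖u₁ t x - u₂ t x‖ ^ 2 := by
      intro x
      have hM0 : 0 ≤ M := (abs_nonneg _).trans (hM x)
      have hin : |⟪(u₁ t - u₂ t) x, FunctionSpaces.Torus.gradient (θ₁ t - θ₂ t) x⟫_ℝ| ≤
          ‖u₁ t x - u₂ t x‖ * ‖FunctionSpaces.Torus.gradient (θ₁ t - θ₂ t) x‖ := by
        rw [Pi.sub_apply]
        exact abs_real_inner_le_norm _ _
      have hprod : |⟪(u₁ t - u₂ t) x, FunctionSpaces.Torus.gradient (θ₁ t - θ₂ t) x⟫_ℝ * θ₂ t x| ≤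
          ‖u₁ t x - u₂ t x‖ * ‖FunctionSpaces.Torus.gradient (θ₁ t - θ₂ t) x‖ * M := by
        rw [abs_mul]
        exact mul_le_mul hin (hM x) (abs_nonneg _) (mul_nonneg (norm_nonneg _) (norm_nonneg _))
      have hY := two_mul_mul_mul_le_of_pos hκ M ‖u₁ t x - u₂ t x‖
        ‖FunctionSpaces.Torus.gradient (θ₁ t - θ₂ t) x‖
      have hle := (le_abs_self _).trans hprod
      linarith
    calc 2 * ∫ x, ⟪(u₁ t - u₂ t) x, FunctionSpaces.Torus.gradient (θ₁ t - θ₂ t) x⟫_ℝ * θ₂ t x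
        = ∫ x, 2 * (⟪(u₁ t - u₂ t) x, FunctionSpaces.Torus.gradient (θ₁ t - θ₂ t) x⟫_ℝ * θ₂ t x) :=
          (integral_const_mul _ _).symm
      _ ≤ ∫ x, (κ * ‖FunctionSpaces.Torus.gradient (θ₁ t - θ₂ t) x‖ ^ 2 +
            M ^ 2 / κ * ‖u₁ t x - u₂ t x‖ ^ 2) :=
          integral_mono (i5.const_mul _) i6 hpt
      _ = κ * scalarGradNormSq (θ₁ t - θ₂ t) + M ^ 2 / κ * ∫ x, ‖u₁ t x - u₂ t x‖ ^ 2 := by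
          rw [integral_add k1 k2, integral_const_mul, integral_const_mul, scalarGradNormSq]
  have hG' : 2 * κ * (∫ x, (θ₁ t - θ₂ t) x * FunctionSpaces.Torus.laplacian (θ₁ t) x) -
      2 * κ * (∫ x, (θ₁ t - θ₂ t) x * FunctionSpaces.Torus.laplacian (θ₂ t) x) =
        -(2 * κ) * scalarGradNormSq (θ₁ t - θ₂ t) := by
    rw [← mul_sub, hG]
    ring
  rw [hT, mul_zero, sub_zero, hG']
  linarith

/-- **Johansson–Sorella 2024, Lemma 2.2 (stability of passive scalars in the drift), classical
form.** Let `θ₁`, `θ₂` be classical solutions on a time set `S ⊇ [a, b]` of the advection–diffusion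
equations `∂ₜθᵢ + uᵢ·∇θᵢ = κΔθᵢ` with the same diffusivity `κ > 0`, smooth divergence-free drifts
`u₁`, `u₂`, and the same datum `θ₁(a) = θ₂(a)`, and let `|θ₂| ≤ M` on `[a, b] × T^d` (in the source
`M = ‖θ_in‖_{L^∞}` by the maximum principle). Then for every `t ∈ [a, b]`
`‖θ₁(t) - θ₂(t)‖²_{L²} + κ ∫ₐᵗ ‖∇(θ₁ - θ₂)(s)‖²_{L²} ds ≤ (M²/κ) ∫ₐᵗ ‖u₁(s) - u₂(s)‖²_{L²} ds`
(source, Lemma 2.2 with `[0, t] ↝ [a, t]`; integrate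
`integral_timeDerivWithin_sub_sq_le_of_drifts` in time by the fundamental theorem of calculus). [cite: JohanssonSorella2024, Lemma 2.2, p. 8] -/
theorem integral_sub_sq_add_dissipation_le_of_drifts (h₁ : IsClassicalScalarTransportOn S κ u₁ θ₁)
    (h₂ : IsClassicalScalarTransportOn S κ u₂ θ₂) (hκ : 0 < κ) {a b : ℝ} (hI : Icc a b ⊆ S)
    (h0 : θ₁ a = θ₂ a) {M : ℝ} (hM : ∀ s ∈ Icc a b, ∀ x, |θ₂ s x| ≤ M) {t : ℝ} (ht : t ∈ Icc a b) :
    (∫ x, (θ₁ t x - θ₂ t x) ^ 2) + κ * ∫ s in a..t, scalarGradNormSq (θ₁ s - θ₂ s) ≤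
      M ^ 2 / κ * ∫ s in a..t, ∫ x, ‖u₁ s x - u₂ s x‖ ^ 2 := by
  rcases eq_or_lt_of_le ht.1 with rfl | hat
  · simp [h0]
  have hab : a < b := hat.trans_le ht.2
  have h₁' := h₁.restrict_Icc hab hI
  have h₂' := h₂.restrict_Icc hab hI
  have hconv : Convex ℝ (Icc a b) := convex_Icc a b
  have hU : UniqueDiffOn ℝ (Icc a b) := uniqueDiffOn_Icc hab
  have hws : FunctionSpaces.Torus.IsSmoothSpaceTimeOn (Icc a b) (fun s x => θ₁ s x - θ₂ s x) :=
    h₁'.smooth_scalar.sub h₂'.smooth_scalar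
  have hδus : FunctionSpaces.Torus.IsSmoothSpaceTimeOn (Icc a b) (fun s x => u₁ s x - u₂ s x) :=
    h₁'.smooth_velocity.sub h₂'.smooth_velocity
  have hφ : FunctionSpaces.Torus.IsSmoothSpaceTimeOn (Icc a b)
      (fun s x => (θ₁ s x - θ₂ s x) * (θ₁ s x - θ₂ s x)) := hws.mul hws
  -- `E(s) = ∫ w(s)²`, `D(s) = ∫ ∂ₜ(w²)(s)`, `G(s) = ‖∇w(s)‖²`, `V(s) = ‖u₁(s) - u₂(s)‖²`
  set D : ℝ → ℝ := fun s => ∫ x, FunctionSpaces.Torus.timeDerivWithin (Icc a b)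
    (fun s x => (θ₁ s x - θ₂ s x) * (θ₁ s x - θ₂ s x)) s x with hD
  set G : ℝ → ℝ := fun s => scalarGradNormSq (θ₁ s - θ₂ s) with hGdef
  set V : ℝ → ℝ := fun s => ∫ x, ‖u₁ s x - u₂ s x‖ ^ 2 with hVdef
  have hderiv : ∀ s ∈ Icc a b, HasDerivWithinAt
      (fun σ => ∫ x, (θ₁ σ x - θ₂ σ x) * (θ₁ σ x - θ₂ σ x)) (D s) (Icc a b) s :=
    fun s hs => hφ.hasDerivWithinAt_integral hconv hs
  have hDc : ContinuousOn D (Icc a b) := (hφ.timeDerivWithin hU).continuousOn_integral hconv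
  have hGc : ContinuousOn G (Icc a b) := by
    have h := hws.continuousOn_scalarGradNormSq hconv hU
    exact h.congr fun s _ => rfl
  have hVc : ContinuousOn V (Icc a b) := hδus.continuousOn_integral_norm_sq hconv
  have hta : Icc a t ⊆ Icc a b := Icc_subset_Icc le_rfl ht.2
  have hsub : uIcc a t ⊆ Icc a b := (uIcc_of_le ht.1).subset.trans hta
  have hDi : IntervalIntegrable D volume a t := (hDc.mono hsub).intervalIntegrable
  have hGi : IntervalIntegrable G volume a t := (hGc.mono hsub).intervalIntegrable
  have hVi : IntervalIntegrable V volume a t := (hVc.mono hsub).intervalIntegrable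
  have hFTC : ∫ s in a..t, D s =
      (∫ x, (θ₁ t x - θ₂ t x) * (θ₁ t x - θ₂ t x)) - ∫ x, (θ₁ a x - θ₂ a x) * (θ₁ a x - θ₂ a x) :=
    intervalIntegral.integral_eq_sub_of_hasDerivAt_of_le ht.1
      (fun s hs => ((hderiv s (hta hs)).continuousWithinAt).mono hta)
      (fun s hs => (hderiv s (hta (Ioo_subset_Icc_self hs))).hasDerivAt
        (Icc_mem_nhds hs.1 (hs.2.trans_le ht.2)))
      hDi
  have hmono : ∫ s in a..t, D s ≤ ∫ s in a..t, (-κ * G s + M ^ 2 / κ * V s) :=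
    intervalIntegral.integral_mono_on ht.1 hDi ((hGi.const_mul _).add (hVi.const_mul _))
      fun s hs => h₁'.integral_timeDerivWithin_sub_sq_le_of_drifts h₂' hκ hU (hta hs) (hM s (hta hs))
  have h0' : ∫ x, (θ₁ a x - θ₂ a x) * (θ₁ a x - θ₂ a x) = 0 := by simp [h0]
  rw [intervalIntegral.integral_add (hGi.const_mul _) (hVi.const_mul _),
    intervalIntegral.integral_const_mul, intervalIntegral.integral_const_mul] at hmono
  have hsq : ∫ x, (θ₁ t x - θ₂ t x) ^ 2 = ∫ x, (θ₁ t x - θ₂ t x) * (θ₁ t x - θ₂ t x) := by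
    simp_rw [sq]
  show (∫ x, (θ₁ t x - θ₂ t x) ^ 2) + κ * (∫ s in a..t, G s) ≤ M ^ 2 / κ * ∫ s in a..t, V s
  rw [hsq]
  linarith

/-- **Johansson–Sorella 2024, Lemma 2.2, as printed** (classical form): for classical solutions
`θ₁`, `θ₂` of `∂ₜθᵢ + uᵢ·∇θᵢ = κΔθᵢ` (`κ > 0`, smooth divergence-free drifts) on `S ⊇ [a, b]`
with the same datum `θ₁(a) = θ₂(a) = θ_in`, `|θ_in| ≤ M`, and every `t ∈ [a, b]`,
`‖θ₁(t) - θ₂(t)‖²_{L²} + κ ∫ₐᵗ ‖∇(θ₁ - θ₂)‖²_{L²} ≤ (M²/κ) ∫ₐᵗ ‖u₁ - u₂‖²_{L²}`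
— the printed constant `‖θ_in‖²_{L^∞}/κ` — by `integral_sub_sq_add_dissipation_le_of_drifts` and
the maximum principle `|θ₂| ≤ M` on `[a, b] × T^d` (`abs_le_of_forall_abs_init_le`). [cite: JohanssonSorella2024, Lemma 2.2, p. 8] -/
theorem integral_sub_sq_add_dissipation_le_of_drifts_init
    (h₁ : IsClassicalScalarTransportOn S κ u₁ θ₁) (h₂ : IsClassicalScalarTransportOn S κ u₂ θ₂)
    (hκ : 0 < κ) {a b : ℝ} (hI : Icc a b ⊆ S) (h0 : θ₁ a = θ₂ a) {M : ℝ}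
    (hM : ∀ x, |θ₂ a x| ≤ M) {t : ℝ} (ht : t ∈ Icc a b) :
    (∫ x, (θ₁ t x - θ₂ t x) ^ 2) + κ * ∫ s in a..t, scalarGradNormSq (θ₁ s - θ₂ s) ≤
      M ^ 2 / κ * ∫ s in a..t, ∫ x, ‖u₁ s x - u₂ s x‖ ^ 2 :=
  h₁.integral_sub_sq_add_dissipation_le_of_drifts h₂ hκ hI h0
    (fun _ hs x => h₂.abs_le_of_forall_abs_init_le hκ.le hI hM hs x) ht

end IsClassicalScalarTransportOn

end Torus

end Literature.Analysis.FluidPDE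

end
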